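/-
Copyright (c) 2026 the pub-hodgecm-mathlib formalisation cell (harness21).  Prover seat hodgecm-mathlib-K2E3-p17 (g9), Track B «K2-LIT» / h413
(`stmt-HodgeConjecture-24833`), line `K2_E3_EllipticInputs`, leaf (nsc-S-A'), D94 brick IRR'' (head): `D'' = Ind_Q(η∘det₂ ⊗ ην^(1/2))` is irreducible.  2026-09-04.
-/
import Summits.HodgeConjecture.HodgeConjecture.Theorems.K2E3GL3OneLinkNestedHighNoPiece       -- (K-d) (this seat): `false_of_piece_X_two`
import Summits.HodgeConjecture.HodgeConjecture.Theorems.K2E3GL3OneLinkNestedHighSplit         -- ★ IRR″-b: `exists_piece_X_two`, `isSmooth_D_high`, `nontrivial_coinvariants_of_isConstituentOf_D_high`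
import Summits.HodgeConjecture.HodgeConjecture.Theorems.K2E3GL3StandardModuleDegenerate       -- ★ WH0: `not_isGeneric_D`
import Summits.HodgeConjecture.HodgeConjecture.Theorems.K2E3GL3DegenerateJacquetVanishing      -- ★ DEG: `coinvariantsMk_whittakerTwist_eq_zero_of_not_isGeneric`
import Summits.HodgeConjecture.HodgeConjecture.Theorems.K2E3LocalFieldAddCharExists            -- ★ `exists_addChar_isContinuousNontrivial`
import Summits.HodgeConjecture.HodgeConjecture.Theorems.K2E3GL3MaximalParabolicRelabel         -- ★ `monotone_twoOne` (`Fin 2` labelling)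
import HarnessLib

/-!
# Crux `H413` — leaf (nsc-S-A′), brick IRR″ (head): THE STANDARD MODULE `D″ = Ind_Q(η∘det₂ ⊗ ην½)` IS IRREDUCIBLE

Cell `hodgecm-mathlib`, Track B; THEOREMS ONLY; count-neutral helper (`--supports stmt-HodgeConjecture-24833 --as helper`).  Letters (C1″, support `{a, aν, aν}`, `a = ην½⁻¹`):
`X = tch(a,aν,aν)`, `D″ = Ind_Q(η∘det₂ ⊗ aν)` (★ STD-EMB spelling), `E(D″) = {X², Y}` (★ IRR″-a).  **`isIrreducible_D_high`** (conditional on the cell binder `h3cell` of ★ E4a,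
VERBATIM for `I(X)`, discharged at the tie by ★ (CELL-3)): a proper non-zero `N ≤ D″` would have an `{X²}`-piece `P ∈ {N, D″ ⁄ N}` (★ IRR″-b `exists_piece_X_two`, parity ★ H0); `P` is a
smooth subquotient of `I(X)` (★ STD-EMB `D″ ↪ I(X)`), `ψ`-degenerate (★ WH0 + ★ DEG + ★ HER) with constituents of non-zero Jacquet module (★ IRR″-b); (K-d) `false_of_piece_X_two`.
[Zelevinsky1980, Thm. 4.2: `⟨[a, aν]⟩ × ⟨[aν]⟩` is irreducible since the segments `[a,aν] ⊃ [aν]` are not linked.]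

HONEST LABEL: HC_CM is proved only modulo the 7 printed citations (2 remaining named inputs: hLiu418 = stmt-HodgeConjecture-24832, h413 =
stmt-HodgeConjecture-24833) until rung 0 closes; count-neutral helper, CONDITIONAL on `h3cell` (★ (CELL-3) pays it at the tie).

## References
* [Zelevinsky1980] A. V. Zelevinsky, *Induced representations of reductive p-adic groups II*, Ann. Sci. ÉNS 13 (1980), Thm. 4.2, Ex. 3.2, Thm. 6.1.
* [BernsteinZelevinsky1977] I. N. Bernstein, A. V. Zelevinsky, *Induced representations of reductive p-adic groups I*, Ann. Sci. ÉNS 10 (1977), Thm. 2.9, Thm. 4.7.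
-/

set_option autoImplicit false
-- the mandated namespace repeats `HodgeConjecture.HodgeConjecture`, as in every `Theorems/*.lean` of this sub-problem
set_option linter.dupNamespace false

noncomputable section

open Module Representation Function Literature.NumberTheory.Automorphic Literature.NumberTheory.Automorphic.Zelevinsky1980
open Literature.NumberTheory.GaloisRepresentations.IsNonarchimedeanLocalField Literature.RepresentationTheory.FiniteGroups Literature.RepresentationTheory.Semisimple
open scoped MatrixGroups NNReal
open Summit.HodgeConjecture.HodgeConjecture.Cruxes.H413.K2E3GL3OneLinkNestedHighNoPiece (false_of_piece_X_two)
open Summit.HodgeConjecture.HodgeConjecture.Cruxes.H413.K2E3GL3OneLinkNestedHighSplit (exists_piece_X_two isSmooth_D_high nontrivial_coinvariants_of_isConstituentOf_D_high)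
open Summit.HodgeConjecture.HodgeConjecture.Cruxes.H413.K2E3GL3OneLinkNestedHighPieces (isOpen_ker_b)
open Summit.HodgeConjecture.HodgeConjecture.Cruxes.H413.K2E3GL3StandardModuleDegenerate (not_isGeneric_D)
open Summit.HodgeConjecture.HodgeConjecture.Cruxes.H413.K2E3GL3DegenerateJacquetVanishing (coinvariantsMk_whittakerTwist_eq_zero_of_not_isGeneric)
open Summit.HodgeConjecture.HodgeConjecture.Cruxes.H413.K2E3GL3StandardModuleEmbedding (exists_injective_not_surjective_intertwiningMap)
open Summit.HodgeConjecture.HodgeConjecture.Cruxes.H413.K2E3DegenerateSubquotientHeredity (forall_mk_whittakerTwist_eq_zero_toRepresentation forall_mk_whittakerTwist_eq_zero_quotientRep)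

namespace Summit.HodgeConjecture.HodgeConjecture.Cruxes.H413.K2E3GL3OneLinkNestedHighIrreducible

variable {F : Type} [Field F] [ValuativeRel F] [TopologicalSpace F] [IsNonarchimedeanLocalField F] (η : Fˣ →* ℂˣ)

omit [ValuativeRel F] [TopologicalSpace F] [IsNonarchimedeanLocalField F] in
/-- The `Fin 2`-labelling `![0,0,1]` of `P_{(2,1)}` is surjective. [folklore] -/
theorem surjective_twoOne : Function.Surjective (![0, 0, 1] : Fin 3 → Fin 2) := fun a => by
  fin_cases a
  · exact ⟨0, rfl⟩
  · exact ⟨2, rfl⟩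

set_option maxHeartbeats 1600000 in  -- cumulative budget of the declaration over large induced-module terms
/-- **IRR″: `D″ = Ind_Q(η∘det₂ ⊗ ην½)` IS IRREDUCIBLE** (conditional on the cell binder `h3cell` for `I(X)`). [cite: Zelevinsky1980, Thm. 4.2, Ex. 3.2] [cite: BernsteinZelevinsky1977, Thm. 2.9, Thm. 4.7] -/
theorem isIrreducible_D_high (hη : IsOpen ((η.ker : Subgroup Fˣ) : Set Fˣ))
    (h3cell : ∀ c : Fin 3 → Fin 2, Monotone c → Function.Surjective c →
      ∀ (W : Type) [AddCommGroup W] [Module ℂ W] (σ : Representation ℂ (Π a : Fin 2, GL {i : Fin 3 // c i = a} F) W),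
        σ.IsIrreducible → σ.IsSmooth → σ.IsSupercuspidal →
        ∀ (N : Subrepresentation (jacquetGL F c (Representation.parabolicIndGL F (id : Fin 3 → Fin 3) ((Representation.trivial ℂ (Π a : Fin 3, GL {i : Fin 3 // (id : Fin 3 → Fin 3) i = a} F) ℂ).twist (∏ a : Fin 3, ((![(η * ((unramifiedTwist F (1 / 2) : QuasiChar F).toMonoidHom)⁻¹), (η * ((unramifiedTwist F (1 / 2) : QuasiChar F).toMonoidHom)), (η * ((unramifiedTwist F (1 / 2) : QuasiChar F).toMonoidHom))] : Fin 3 → (Fˣ →* ℂˣ)) a).comp (Matrix.GeneralLinearGroup.det.comp (Pi.evalMonoidHom (fun a : Fin 3 => GL {i : Fin 3 // (id : Fin 3 → Fin 3) i = a} F) a)))))))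
          (q : N.toRepresentation.IntertwiningMap σ), q = 0) :
    (Representation.parabolicIndGL F (![false, false, true] : Fin 3 → Bool) ((Representation.trivial ℂ (Π a : Bool, GL {i : Fin 3 // (![false, false, true] : Fin 3 → Bool) i = a} F) ℂ).twist ((η.comp (Matrix.GeneralLinearGroup.det.comp (Pi.evalMonoidHom (fun a : Bool => GL {i : Fin 3 // (![false, false, true] : Fin 3 → Bool) i = a} F) false))) * ((η * ((unramifiedTwist F (1 / 2) : QuasiChar F).toMonoidHom)).comp (Matrix.GeneralLinearGroup.det.comp (Pi.evalMonoidHom (fun a : Bool => GL {i : Fin 3 // (![false, false, true] : Fin 3 → Bool) i = a} F) true)))))).IsIrreducible := by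
  haveI : IsTopologicalRing F := inferInstance
  have hb : IsOpen ((((η * ((unramifiedTwist F (1 / 2) : QuasiChar F).toMonoidHom))).ker : Subgroup Fˣ) : Set Fˣ) := isOpen_ker_b η hη
  have hD := isSmooth_D_high η
  -- `D″ ↪ I(X)` (★ STD-EMB), `I(X)` smooth, the cell hypothesis at `c = ![0,0,1]`
  obtain ⟨Φ, hΦ, -, -⟩ := exists_injective_not_surjective_intertwiningMap η (η * ((unramifiedTwist F (1 / 2) : QuasiChar F).toMonoidHom)) hη hb
  have hIsm : (Representation.parabolicIndGL F (id : Fin 3 → Fin 3) ((Representation.trivial ℂ (Π a : Fin 3, GL {i : Fin 3 // (id : Fin 3 → Fin 3) i = a} F) ℂ).twist (∏ a : Fin 3, ((![(η * ((unramifiedTwist F (1 / 2) : QuasiChar F).toMonoidHom)⁻¹), (η * ((unramifiedTwist F (1 / 2) : QuasiChar F).toMonoidHom)), (η * ((unramifiedTwist F (1 / 2) : QuasiChar F).toMonoidHom))] : Fin 3 → (Fˣ →* ℂˣ)) a).comp (Matrix.GeneralLinearGroup.det.comp (Pi.evalMonoidHom (fun a : Fin 3 => GL {i : Fin 3 // (id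 : Fin 3 → Fin 3) i = a} F) a))))).IsSmooth := Representation.isSmooth_smoothInd _ _
  have hcell := h3cell (![0, 0, 1] : Fin 3 → Fin 2) K2E3GL3MaximalParabolicRelabel.monotone_twoOne surjective_twoOne
  -- `D″` is `ψ`-degenerate for a continuous non-trivial `ψ` (★ WH0 + ★ DEG), and so are its pieces (★ HER); constituents of `D″` have `r_B ≠ 0` (★ IRR″-b)
  obtain ⟨ψ, hψ⟩ := K2E3LocalFieldAddCharExists.exists_addChar_isContinuousNontrivial F
  have hdegD : ∀ v, Coinvariants.mk (whittakerTwist (Representation.parabolicIndGL F (![false, false, true] : Fin 3 → Bool) ((Representation.trivial ℂ (Π a : Bool, GL {i : Fin 3 // (![false, false, true] : Fin 3 → Bool) i = a} F) ℂ).twist ((η.comp (Matrix.GeneralLinearGroup.det.comp (Pi.evalMonoidHom (fun a : Bool => GL {i : Fin 3 // (![false, false, true] : Fin 3 → Bool) i = a} F) false))) * ((η * ((unramifiedTwist F (1 / 2) : QuasiChar F).toMonoidHom)).comp (Matrix.GeneralLinearGroup.det.comp (Pi.evalMonoidHom (fun a : Bool => GL {i : Fin 3 // (![false, false, true] : Fin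 3 → Bool) i = a} F) true)))))) ψ) v = 0 :=
    fun v => coinvariantsMk_whittakerTwist_eq_zero_of_not_isGeneric _ ψ (not_isGeneric_D η (η * ((unramifiedTwist F (1 / 2) : QuasiChar F).toMonoidHom)) hη hb ψ hψ) v
  have hJ := nontrivial_coinvariants_of_isConstituentOf_D_high η hη h3cell
  -- `D″ ≠ 0`: `mult D″ X = 2`
  have hmult := (K2E3GL3OneLinkNestedHighPieces.finrank_weightSpace_D_high η hη (fun m : (Π a : Fin 3, GL {i : Fin 3 // (id : Fin 3 → Fin 3) i = a} F) => ((((∏ a : Fin 3, ((![(η * ((unramifiedTwist F (1 / 2) : QuasiChar F).toMonoidHom)⁻¹), (η * ((unramifiedTwist F (1 / 2) : QuasiChar F).toMonoidHom)), (η * ((unramifiedTwist F (1 / 2) : QuasiChar F).toMonoidHom))] : Fin 3 → (Fˣ →* ℂˣ)) a).comp (Matrix.GeneralLinearGroup.det.comp (Pi.evalMonoidHom (fun a : Fin 3 => GL {i : Fin 3 // (id : Fin 3 → Fin 3) i = a} F) a)))) m : ℂˣ) : ℂ))).2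
  rw [if_pos rfl, if_neg (K2E3GL3OneLinkNestedHighPieces.tch_X_ne_Y η)] at hmult
  haveI hfdD := (K2E3GL3OneLinkNestedHighPieces.finrank_weightSpace_D_high η hη (fun m : (Π a : Fin 3, GL {i : Fin 3 // (id : Fin 3 → Fin 3) i = a} F) => ((((∏ a : Fin 3, ((![(η * ((unramifiedTwist F (1 / 2) : QuasiChar F).toMonoidHom)⁻¹), (η * ((unramifiedTwist F (1 / 2) : QuasiChar F).toMonoidHom)), (η * ((unramifiedTwist F (1 / 2) : QuasiChar F).toMonoidHom))] : Fin 3 → (Fˣ →* ℂˣ)) a).comp (Matrix.GeneralLinearGroup.det.comp (Pi.evalMonoidHom (fun a : Fin 3 => GL {i : Fin 3 // (id : Fin 3 → Fin 3) i = a} F) a)))) m : ℂˣ) : ℂ))).1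
  haveI hnt : Nontrivial (SmoothInd (standardParabolicGL F (![false, false, true] : Fin 3 → Bool)) (Representation.twist ((((Representation.trivial ℂ (Π a : Bool, GL {i : Fin 3 // (![false, false, true] : Fin 3 → Bool) i = a} F) ℂ).twist ((η.comp (Matrix.GeneralLinearGroup.det.comp (Pi.evalMonoidHom (fun a : Bool => GL {i : Fin 3 // (![false, false, true] : Fin 3 → Bool) i = a} F) false))) * ((η * ((unramifiedTwist F (1 / 2) : QuasiChar F).toMonoidHom)).comp (Matrix.GeneralLinearGroup.det.comp (Pi.evalMonoidHom (fun a : Bool => GL {i : Fin 3 // (![false, false, true] : Fin 3 → Bool) i = a} F) true)))))).comp (leviProjection F (![false, false, true] : Fin 3 → Bool))) (rootDeltaChar (standardParabolicGL F (![false, false, true] : Fin 3 → Bool))))) := by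
    by_contra hnt
    haveI : Subsingleton (SmoothInd (standardParabolicGL F (![false, false, true] : Fin 3 → Bool)) (Representation.twist ((((Representation.trivial ℂ (Π a : Bool, GL {i : Fin 3 // (![false, false, true] : Fin 3 → Bool) i = a} F) ℂ).twist ((η.comp (Matrix.GeneralLinearGroup.det.comp (Pi.evalMonoidHom (fun a : Bool => GL {i : Fin 3 // (![false, false, true] : Fin 3 → Bool) i = a} F) false))) * ((η * ((unramifiedTwist F (1 / 2) : QuasiChar F).toMonoidHom)).comp (Matrix.GeneralLinearGroup.det.comp (Pi.evalMonoidHom (fun a : Bool => GL {i : Fin 3 // (![false, false, true] : Fin 3 → Bool) i = a} F) true)))))).comp (leviProjection F (![false, false, true] : Fin 3 → Bool))) (rootDeltaChar (standardParabolicGL F (![false, false, true] : Fin 3 → Bool))))) :=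
      not_nontrivial_iff_subsingleton.1 hnt
    haveI : Subsingleton (restrictUnipotentGL F (id : Fin 3 → Fin 3) (Representation.parabolicIndGL F (![false, false, true] : Fin 3 → Bool) ((Representation.trivial ℂ (Π a : Bool, GL {i : Fin 3 // (![false, false, true] : Fin 3 → Bool) i = a} F) ℂ).twist ((η.comp (Matrix.GeneralLinearGroup.det.comp (Pi.evalMonoidHom (fun a : Bool => GL {i : Fin 3 // (![false, false, true] : Fin 3 → Bool) i = a} F) false))) * ((η * ((unramifiedTwist F (1 / 2) : QuasiChar F).toMonoidHom)).comp (Matrix.GeneralLinearGroup.det.comp (Pi.evalMonoidHom (fun a : Bool => GL {i : Fin 3 // (![false, false, true] : Fin 3 → Bool) i = a} F) true))))))).Coinvariants :=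
      ⟨fun x y => by
        obtain ⟨v, rfl⟩ := Coinvariants.mk_surjective _ x
        obtain ⟨w, rfl⟩ := Coinvariants.mk_surjective _ y
        rw [Subsingleton.elim v w]⟩
    have h0 : finrank ℂ ↥(⨅ m, Module.End.maxGenEigenspace (Representation.normalizedJacquetGL F (id : Fin 3 → Fin 3) (Representation.parabolicIndGL F (![false, false, true] : Fin 3 → Bool) ((Representation.trivial ℂ (Π a : Bool, GL {i : Fin 3 // (![false, false, true] : Fin 3 → Bool) i = a} F) ℂ).twist ((η.comp (Matrix.GeneralLinearGroup.det.comp (Pi.evalMonoidHom (fun a : Bool => GL {i : Fin 3 // (![false, false, true] : Fin 3 → Bool) i = a} F) false))) * ((η * ((unramifiedTwist F (1 / 2) : QuasiChar F).toMonoidHom)).comp (Matrix.GeneralLinearGroup.det.comp (Pi.evalMonoidHom (fun a : Bool => GL {i : Fin 3 // (![false, false, true] : Fin 3 → Bool) i = a} F) true)))))) m) ((fun m : (Π a : Fin 3, GL {i : Fin 3 // (id : Fin 3 → Fin 3) i = a} F) => ((((∏ a : Fin 3, ((![(η * ((unramifiedTwist F (1 / 2) : QuasiChar F).toMonoidHom)⁻¹),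 (η * ((unramifiedTwist F (1 / 2) : QuasiChar F).toMonoidHom)), (η * ((unramifiedTwist F (1 / 2) : QuasiChar F).toMonoidHom))] : Fin 3 → (Fˣ →* ℂˣ)) a).comp (Matrix.GeneralLinearGroup.det.comp (Pi.evalMonoidHom (fun a : Fin 3 => GL {i : Fin 3 // (id : Fin 3 → Fin 3) i = a} F) a)))) m : ℂˣ) : ℂ)) m)) = 0 := by
      rw [finrank_zero_iff_forall_zero]
      intro x
      exact Subsingleton.elim _ _
    exact absurd (hmult.symm.trans h0) (by norm_num)
  haveI : Nontrivial (Subrepresentation (Representation.parabolicIndGL F (![false, false, true] : Fin 3 → Bool) ((Representation.trivial ℂ (Π a : Bool, GL {i : Fin 3 // (![false, false, true] : Fin 3 → Bool) i = a} F) ℂ).twist ((η.comp (Matrix.GeneralLinearGroup.det.comp (Pi.evalMonoidHom (fun a : Bool => GL {i : Fin 3 // (![false, false, true] : Fin 3 → Bool) i = a} F) false))) * ((η * ((unramifiedTwist F (1 / 2) : QuasiChar F).toMonoidHom)).comp (Matrix.GeneralLinearGroup.det.comp (Pi.evalMonoidHom (fun a : Bool => GL {i : Fin 3 // (![false, false,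 true] : Fin 3 → Bool) i = a} F) true))))))) :=
    ⟨⟨⊥, ⊤, fun h => by
      obtain ⟨v, hv⟩ := exists_ne (0 : SmoothInd (standardParabolicGL F (![false, false, true] : Fin 3 → Bool)) (Representation.twist ((((Representation.trivial ℂ (Π a : Bool, GL {i : Fin 3 // (![false, false, true] : Fin 3 → Bool) i = a} F) ℂ).twist ((η.comp (Matrix.GeneralLinearGroup.det.comp (Pi.evalMonoidHom (fun a : Bool => GL {i : Fin 3 // (![false, false, true] : Fin 3 → Bool) i = a} F) false))) * ((η * ((unramifiedTwist F (1 / 2) : QuasiChar F).toMonoidHom)).comp (Matrix.GeneralLinearGroup.det.comp (Pi.evalMonoidHom (fun a : Bool => GL {i : Fin 3 // (![false, false, true] : Fin 3 → Bool) i = a} F) true)))))).comp (leviProjection F (![false, false, true] : Fin 3 → Bool))) (rootDeltaChar (standardParabolicGL F (![false, false, true] : Fin 3 → Bool)))))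
      have : v ∈ (⊥ : Subrepresentation (Representation.parabolicIndGL F (![false, false, true] : Fin 3 → Bool) ((Representation.trivial ℂ (Π a : Bool, GL {i : Fin 3 // (![false, false, true] : Fin 3 → Bool) i = a} F) ℂ).twist ((η.comp (Matrix.GeneralLinearGroup.det.comp (Pi.evalMonoidHom (fun a : Bool => GL {i : Fin 3 // (![false, false, true] : Fin 3 → Bool) i = a} F) false))) * ((η * ((unramifiedTwist F (1 / 2) : QuasiChar F).toMonoidHom)).comp (Matrix.GeneralLinearGroup.det.comp (Pi.evalMonoidHom (fun a : Bool => GL {i : Fin 3 // (![false, false, true] : Fin 3 → Bool) i = a} F) true))))))) := by rw [h]; trivial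
      exact hv ((Submodule.mem_bot ℂ).1 this)⟩⟩
  refine ⟨fun N => ?_⟩
  by_contra hN
  push Not at hN
  rcases exists_piece_X_two η hη h3cell N hN.1 hN.2 with ⟨hfd, hXN, h0N⟩ | ⟨hfd, hXQ, h0Q⟩
  · -- the piece `N`
    haveI := hfd
    haveI : Nontrivial ↥N.toSubmodule := Submodule.nontrivial_iff_ne_bot.2 fun h => hN.1 (Subrepresentation.toSubmodule_injective h)
    obtain ⟨idN, hidN⟩ : ∃ f : N.toRepresentation.IntertwiningMap N.toRepresentation, Function.Surjective f :=
      ⟨Representation.IntertwiningMap.id _, fun v => ⟨v, rfl⟩⟩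
    exact false_of_piece_X_two η hη (Representation.parabolicIndGL F (id : Fin 3 → Fin 3) ((Representation.trivial ℂ (Π a : Fin 3, GL {i : Fin 3 // (id : Fin 3 → Fin 3) i = a} F) ℂ).twist (∏ a : Fin 3, ((![(η * ((unramifiedTwist F (1 / 2) : QuasiChar F).toMonoidHom)⁻¹), (η * ((unramifiedTwist F (1 / 2) : QuasiChar F).toMonoidHom)), (η * ((unramifiedTwist F (1 / 2) : QuasiChar F).toMonoidHom))] : Fin 3 → (Fˣ →* ℂˣ)) a).comp (Matrix.GeneralLinearGroup.det.comp (Pi.evalMonoidHom (fun a : Fin 3 => GL {i : Fin 3 // (id : Fin 3 → Fin 3) i = a} F) a))))) hIsm hcell N.toRepresentation (hD.toRepresentation N) N.toRepresentation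
      (Φ.comp (Subrepresentation.subtypeIntertwiningMap N)) (hΦ.comp (Subrepresentation.subtypeIntertwiningMap_injective N)) idN hidN
      (fun r hr => hJ r (hr.of_subrepresentation N)) ψ hψ (fun v => forall_mk_whittakerTwist_eq_zero_toRepresentation _ hD hψ.1 hdegD N v) hXN h0N
  · -- the piece `D″ ⁄ N`
    haveI := hfd
    haveI : Nontrivial (SmoothInd (standardParabolicGL F (![false, false, true] : Fin 3 → Bool)) (Representation.twist ((((Representation.trivial ℂ (Π a : Bool, GL {i : Fin 3 // (![false, false, true] : Fin 3 → Bool) i = a} F) ℂ).twist ((η.comp (Matrix.GeneralLinearGroup.det.comp (Pi.evalMonoidHom (fun a : Bool => GL {i : Fin 3 // (![false, false, true] : Fin 3 → Bool) i = a} F) false))) * ((η * ((unramifiedTwist F (1 / 2) : QuasiChar F).toMonoidHom)).comp (Matrix.GeneralLinearGroup.det.comp (Pi.evalMonoidHom (fun a : Bool => GL {i : Fin 3 // (![false, false, true] : Fin 3 → Bool) i = a} F) true)))))).comp (leviProjection F (![false, false, true] : Fin 3 → Bool))) (rootDeltaChar (standardParabolicGL F (![false, false, true] : Fin 3 → Bool))))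 ⧸ N.toSubmodule) :=
      Submodule.Quotient.nontrivial_iff.2 fun h => hN.2 (Subrepresentation.toSubmodule_injective h)
    exact false_of_piece_X_two η hη (Representation.parabolicIndGL F (id : Fin 3 → Fin 3) ((Representation.trivial ℂ (Π a : Fin 3, GL {i : Fin 3 // (id : Fin 3 → Fin 3) i = a} F) ℂ).twist (∏ a : Fin 3, ((![(η * ((unramifiedTwist F (1 / 2) : QuasiChar F).toMonoidHom)⁻¹), (η * ((unramifiedTwist F (1 / 2) : QuasiChar F).toMonoidHom)), (η * ((unramifiedTwist F (1 / 2) : QuasiChar F).toMonoidHom))] : Fin 3 → (Fˣ →* ℂˣ)) a).comp (Matrix.GeneralLinearGroup.det.comp (Pi.evalMonoidHom (fun a : Fin 3 => GL {i : Fin 3 // (id : Fin 3 → Fin 3) i = a} F) a))))) hIsm hcell N.quotientRep (hD.quotientRep N) (Representation.parabolicIndGL F (![false, false, true] : Fin 3 → Bool) ((Representation.trivial ℂ (Π a : Bool, GL {i : Fin 3 // (![false, false, true] : Fin 3 → Bool) i = a} F) ℂ).twist ((η.comp (Matrix.GeneralLinearGroup.det.comp (Pi.evalMonoidHom (fun a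 : Bool => GL {i : Fin 3 // (![false, false, true] : Fin 3 → Bool) i = a} F) false))) * ((η * ((unramifiedTwist F (1 / 2) : QuasiChar F).toMonoidHom)).comp (Matrix.GeneralLinearGroup.det.comp (Pi.evalMonoidHom (fun a : Bool => GL {i : Fin 3 // (![false, false, true] : Fin 3 → Bool) i = a} F) true))))))
      Φ hΦ N.mkQ N.mkQ_surjective (fun r hr => hJ r (hr.of_quotientRep N)) ψ hψ (fun v => forall_mk_whittakerTwist_eq_zero_quotientRep _ ψ hdegD N v) hXQ h0Q

end Summit.HodgeConjecture.HodgeConjecture.Cruxes.H413.K2E3GL3OneLinkNestedHighIrreducible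

end
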